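import Literature.Probability.RandomPlanarGeometry.SAWTiles
import HarnessLib

/-!
# Connectors between tiles and the arena of a tile (geometry for the polygon-insertion surgery
# of Duminil-Copin–Kozma–Yadin 2014, Theorem 6)

Companion of `SAWTiles.lean` (tiles `tile m r τ = B_∞(L τ, h)`, inner boxes `innerBox m r τ`,
ports `portA/portB m r τ d`). Following H. Duminil-Copin, G. Kozma, A. Yadin, *Supercritical
self-avoiding walks are space-filling*, Ann. IHP Probab. Stat. 50 (2014), §3, polygons in the
inner boxes of adjacent tiles are merged through their facing cardinal edges; with our margins
the facing ports are joined by the two straight CONNECTORS `connA/connB m r τ d` of `2r + 2`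
steps. This file defines the connectors, their interior cells `connCells m r τ d`, and the ARENA
`arena m r τ₀` of a tile (the coordinate box `[L τ₀ᵢ - (h+r+1), L τ₀ᵢ + (h+r)]²`: the tile together
with the facing margins of its four neighbours), and proves the disjointness facts used by the
surgery: connector cells lie in the two tiles they join and in no inner box, connectors on
different sides of a tile are disjoint, inner boxes of other tiles and connectors between other
tiles avoid the arena, and the sites one step inside the arena from the ports of a neighbour
(`portA_step_coords`, `port_steps_mem_arena`). All objects are in the sub-namespace
`OddTile` of `SAWTiles.lean` (distinct from the even-box geometry
`SupercriticalSAW.innerBox/rungCells` of `SupercriticalSAWSpaceFillingBoxes.lean`, see the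
module docstring of `SAWTiles.lean`).
-/

noncomputable section

open Finset Literature.Probability.LatticeModels

namespace Literature.Probability.RandomPlanarGeometry.SAW

namespace OddTile

variable {m r : ℕ}

/-! ### Connectors between facing ports of adjacent tiles -/

variable (m r) in
/-- The connector from `portA τ d` to the facing `portA (τ + d) (-d)`: the straight segment of
`2r + 2` steps in direction `d` (it runs in the margins between the two inner boxes).
[cite: DuminilCopinKozmaYadin2014, §3 (merging adjacent polygons)] -/
def connA (τ : Site 2) (d : Dir) : List (Site 2) := seg (portA m r τ d) d.vec (2 * r + 2)

variable (m r) in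
/-- The connector from `portB τ d` to the facing `portB (τ + d) (-d)`. [cite: DuminilCopinKozmaYadin2014, §3 (merging adjacent polygons)] -/
def connB (τ : Site 2) (d : Dir) : List (Site 2) := seg (portB m r τ d) d.vec (2 * r + 2)

/-- The far end of `connA` is the facing port of the neighbouring tile. [cite: DuminilCopinKozmaYadin2014, §3 (adjacent boxes: x ∼ z, y ∼ t)] -/
theorem portA_add_eq (τ : Site 2) (d : Dir) :
    portA m r τ d + ((2 * r + 2 : ℕ) : ℤ) • d.vec = portA m r (τ + d.vec) d.neg := by
  rw [site_eq_iff]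
  cases d <;> simp [portA, Dir.vec, Dir.neg, side_eq, hw_eq] <;> ring_nf

/-- The far end of `connB` is the facing port of the neighbouring tile. [cite: DuminilCopinKozmaYadin2014, §3 (adjacent boxes: x ∼ z, y ∼ t)] -/
theorem portB_add_eq (τ : Site 2) (d : Dir) :
    portB m r τ d + ((2 * r + 2 : ℕ) : ℤ) • d.vec = portB m r (τ + d.vec) d.neg := by
  rw [site_eq_iff]
  cases d <;> simp [portB, Dir.vec, Dir.neg, side_eq, hw_eq] <;> ring_nf

/-! ### Connector cells -/

variable (m r) in
/-- The interior vertices of the connector `connA τ d` (all but its two port endpoints): the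
segment of `2r` steps from `portA τ d + d`. [cite: DuminilCopinKozmaYadin2014, §3 (merging adjacent polygons)] -/
def connInnerA (τ : Site 2) (d : Dir) : List (Site 2) := seg (portA m r τ d + d.vec) d.vec (2 * r)

variable (m r) in
/-- The interior vertices of the connector `connB τ d`. [cite: DuminilCopinKozmaYadin2014, §3 (merging adjacent polygons)] -/
def connInnerB (τ : Site 2) (d : Dir) : List (Site 2) := seg (portB m r τ d + d.vec) d.vec (2 * r)

variable (m r) in
/-- The connector cells of the pair of tiles `τ, τ + d`: all interior vertices of the two
connectors. [cite: DuminilCopinKozmaYadin2014, §3 (merging adjacent polygons)] -/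
def connCells (τ : Site 2) (d : Dir) : Finset (Site 2) :=
  (connInnerA m r τ d ++ connInnerB m r τ d).toFinset

/-- The connector is its first port, the interior, and the facing port. [folklore] -/
theorem connA_eq (τ : Site 2) (d : Dir) :
    connA m r τ d = portA m r τ d :: (connInnerA m r τ d ++ [portA m r (τ + d.vec) d.neg]) := by
  rw [connA, show 2 * r + 2 = (2 * r + 1) + 1 by ring, seg_succ', connInnerA, seg_succ,
    ← portA_add_eq]
  congr 2
  simp only [List.cons.injEq, and_true]
  push_cast
  module

/-- The connector is its first port, the interior, and the facing port. [folklore] -/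
theorem connB_eq (τ : Site 2) (d : Dir) :
    connB m r τ d = portB m r τ d :: (connInnerB m r τ d ++ [portB m r (τ + d.vec) d.neg]) := by
  rw [connB, show 2 * r + 2 = (2 * r + 1) + 1 by ring, seg_succ', connInnerB, seg_succ,
    ← portB_add_eq]
  congr 2
  simp only [List.cons.injEq, and_true]
  push_cast
  module

/-- Interior connector vertices visit no vertex twice. [folklore] -/
theorem nodup_connInnerA (τ : Site 2) (d : Dir) : (connInnerA m r τ d).Nodup :=
  nodup_seg _ (Dir.vec_ne_zero d) _

/-- Interior connector vertices visit no vertex twice. [folklore] -/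
theorem nodup_connInnerB (τ : Site 2) (d : Dir) : (connInnerB m r τ d).Nodup :=
  nodup_seg _ (Dir.vec_ne_zero d) _

/-- Interior connector vertices form a chain. [folklore] -/
theorem isChain_connInnerA (τ : Site 2) (d : Dir) : (connInnerA m r τ d).IsChain (zdGraph 2).Adj :=
  isChain_seg _ (Dir.adj_zero_vec d) _

/-- Interior connector vertices form a chain. [folklore] -/
theorem isChain_connInnerB (τ : Site 2) (d : Dir) : (connInnerB m r τ d).IsChain (zdGraph 2).Adj :=
  isChain_seg _ (Dir.adj_zero_vec d) _

/-- Coordinates of the interior vertices of `connA`, east and north directions.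
[folklore] -/
theorem mem_connInnerA_iff (τ : Site 2) (d : Dir) (w : Site 2) :
    w ∈ connInnerA m r τ d ↔ ∃ k : ℕ, k ≤ 2 * r ∧
      match d with
      | .E => w 0 = (side m r : ℤ) * τ 0 + m + 1 + k ∧ w 1 = (side m r : ℤ) * τ 1 - 1
      | .N => w 0 = (side m r : ℤ) * τ 0 - 1 ∧ w 1 = (side m r : ℤ) * τ 1 + m + 1 + k
      | .W => w 0 = (side m r : ℤ) * τ 0 - (m + 1) - 1 - k ∧ w 1 = (side m r : ℤ) * τ 1 - 1
      | .S => w 0 = (side m r : ℤ) * τ 0 - 1 ∧ w 1 = (side m r : ℤ) * τ 1 - (m + 1) - 1 - k := by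
  cases d <;> simp only [connInnerA, portA, Dir.vec, pt_add_pt, mem_seg_pt_iff] <;>
    refine exists_congr fun k => and_congr_right fun _ => ?_ <;> omega

/-- Coordinates of the interior vertices of `connB`. [folklore] -/
theorem mem_connInnerB_iff (τ : Site 2) (d : Dir) (w : Site 2) :
    w ∈ connInnerB m r τ d ↔ ∃ k : ℕ, k ≤ 2 * r ∧
      match d with
      | .E => w 0 = (side m r : ℤ) * τ 0 + m + 1 + k ∧ w 1 = (side m r : ℤ) * τ 1
      | .N => w 0 = (side m r : ℤ) * τ 0 ∧ w 1 = (side m r : ℤ) * τ 1 + m + 1 + k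
      | .W => w 0 = (side m r : ℤ) * τ 0 - (m + 1) - 1 - k ∧ w 1 = (side m r : ℤ) * τ 1
      | .S => w 0 = (side m r : ℤ) * τ 0 ∧ w 1 = (side m r : ℤ) * τ 1 - (m + 1) - 1 - k := by
  cases d <;> simp only [connInnerB, portB, Dir.vec, pt_add_pt, mem_seg_pt_iff] <;>
    refine exists_congr fun k => and_congr_right fun _ => ?_ <;> omega

/-- Membership in the connector cells. [folklore] -/
theorem mem_connCells_iff {τ : Site 2} {d : Dir} {w : Site 2} :
    w ∈ connCells m r τ d ↔ w ∈ connInnerA m r τ d ∨ w ∈ connInnerB m r τ d := by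
  rw [connCells, List.mem_toFinset, List.mem_append]

/-- Connector cells lie in the union of the two tiles they join. [cite: DuminilCopinKozmaYadin2014, §3 (merging adjacent polygons)] -/
theorem mem_tile_of_mem_connCells {τ : Site 2} {d : Dir} {w : Site 2} (h : w ∈ connCells m r τ d) :
    w ∈ tile m r τ ∨ w ∈ tile m r (τ + d.vec) := by
  have hL := side_eq (m := m) (r := r); have hh := hw_eq (m := m) (r := r)
  rw [mem_connCells_iff, mem_connInnerA_iff, mem_connInnerB_iff] at h
  simp only [mem_tile_iff, Fin.forall_fin_two, Pi.add_apply] at h ⊢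
  cases d <;> simp only [Dir.vec, pt_apply_zero, pt_apply_one, mul_add, mul_one, mul_neg,
    add_zero] at h ⊢ <;> rcases h with ⟨k, hk, h0, h1⟩ | ⟨k, hk, h0, h1⟩ <;> omega

/-- Connector cells lie in no inner box. [cite: DuminilCopinKozmaYadin2014, §3 (merging adjacent polygons)] -/
theorem not_mem_innerBox_of_mem_connCells {τ : Site 2} {d : Dir} {w : Site 2}
    (h : w ∈ connCells m r τ d) (τ' : Site 2) : w ∉ innerBox m r τ' := by
  have hL := side_eq (m := m) (r := r); have hh := hw_eq (m := m) (r := r)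
  intro h'
  rw [mem_connCells_iff, mem_connInnerA_iff, mem_connInnerB_iff] at h
  have h0 := mem_innerBox_iff.1 h' 0
  have h1 := mem_innerBox_iff.1 h' 1
  -- compare the coordinate along `d` with the inner boxes of the tiles `τ'`
  cases d <;> simp only at h
  · rcases lt_trichotomy (τ' 0) (τ 0) with ht | ht | ht
    · have := side_mul_le (m := m) (r := r) ht; omega
    · rw [ht] at h0; omega
    · have := side_mul_le (m := m) (r := r) ht; omega
  · rcases lt_trichotomy (τ' 1) (τ 1) with ht | ht | ht
    · have := side_mul_le (m := m) (r := r) ht; omega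
    · rw [ht] at h1; omega
    · have := side_mul_le (m := m) (r := r) ht; omega
  · rcases lt_trichotomy (τ' 0) (τ 0) with ht | ht | ht
    · have := side_mul_le (m := m) (r := r) ht; omega
    · rw [ht] at h0; omega
    · have := side_mul_le (m := m) (r := r) ht; omega
  · rcases lt_trichotomy (τ' 1) (τ 1) with ht | ht | ht
    · have := side_mul_le (m := m) (r := r) ht; omega
    · rw [ht] at h1; omega
    · have := side_mul_le (m := m) (r := r) ht; omega

/-- The connector cells of `τ, τ + d` are those of `τ + d, τ` (reverse the connectors).
[folklore] -/
theorem connCells_eq_neg (τ : Site 2) (d : Dir) :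
    connCells m r τ d = connCells m r (τ + d.vec) d.neg := by
  have hL := side_eq (m := m) (r := r); have hh := hw_eq (m := m) (r := r)
  ext w
  simp only [mem_connCells_iff, mem_connInnerA_iff, mem_connInnerB_iff, Pi.add_apply]
  cases d <;> simp only [Dir.neg, Dir.vec, pt_apply_zero, pt_apply_one, mul_add, mul_one,
    mul_neg, add_zero] <;>
  · constructor <;> rintro (⟨k, hk, h⟩ | ⟨k, hk, h⟩)
    · exact Or.inl ⟨2 * r - k, by omega, by omega⟩
    · exact Or.inr ⟨2 * r - k, by omega, by omega⟩
    · exact Or.inl ⟨2 * r - k, by omega, by omega⟩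
    · exact Or.inr ⟨2 * r - k, by omega, by omega⟩

/-- Connectors on different sides of a tile are disjoint. [folklore] -/
theorem disjoint_connCells_of_ne (τ : Site 2) {d d' : Dir} (hdd' : d ≠ d') :
    Disjoint (connCells m r τ d) (connCells m r τ d') := by
  rw [Finset.disjoint_left]
  intro w hw hw'
  have hL := side_eq (m := m) (r := r); have hh := hw_eq (m := m) (r := r)
  rw [mem_connCells_iff, mem_connInnerA_iff, mem_connInnerB_iff] at hw hw'
  cases d <;> cases d' <;> first
    | exact absurd rfl hdd'
    | (simp only at hw hw'
       rcases hw with ⟨k, hk, h0, h1⟩ | ⟨k, hk, h0, h1⟩ <;>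
         rcases hw' with ⟨k', hk', h0', h1'⟩ | ⟨k', hk', h0', h1'⟩ <;> omega)

/-- The two connectors of one pair of tiles are disjoint. [folklore] -/
theorem disjoint_connInnerA_connInnerB (τ : Site 2) (d : Dir) :
    List.Disjoint (connInnerA m r τ d) (connInnerB m r τ d) := by
  intro w hw hw'
  rw [mem_connInnerA_iff] at hw
  rw [mem_connInnerB_iff] at hw'
  cases d <;> simp only at hw hw' <;> omega

/-! ### The arena around a tile -/

variable (m r) in
/-- The arena of tile `τ₀`: the tile together with the facing margins of its four neighbours,
namely the coordinate box `[L τ₀ᵢ - (h+r+1), L τ₀ᵢ + (h+r)]²` — exactly the sites strictly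
between the inner boxes of the neighbouring tiles. When `τ₀` carries no polygon and no
connector ends at `τ₀`, the arena is free of all inserted structure. [cite: DuminilCopinKozmaYadin2014, §3] -/
def arena (τ₀ : Site 2) : Finset (Site 2) :=
  Fintype.piFinset fun i => Icc (ctr m r τ₀ i - (hw m r + r + 1)) (ctr m r τ₀ i + (hw m r + r))

/-- Membership in the arena. [folklore] -/
theorem mem_arena_iff {τ₀ w : Site 2} :
    w ∈ arena m r τ₀ ↔ ∀ i, (side m r : ℤ) * τ₀ i - (hw m r + r + 1) ≤ w i ∧
      w i ≤ (side m r : ℤ) * τ₀ i + (hw m r + r) := by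
  simp [arena, Fintype.mem_piFinset]

/-- The arena contains the tile. [folklore] -/
theorem tile_subset_arena (τ₀ : Site 2) : tile m r τ₀ ⊆ arena m r τ₀ := fun w hw =>
  mem_arena_iff.2 fun i => by have := mem_tile_iff.1 hw i; omega

/-- Arena sites are within `ℓ¹`-distance `2(h+r+1)` of the centre. [folklore] -/
theorem l1dist_le_of_mem_arena {τ₀ w : Site 2} (h : w ∈ arena m r τ₀) :
    l1dist w (ctr m r τ₀) ≤ 2 * (hw m r + r + 1) := by
  rw [mem_arena_iff] at h
  have h0 := h 0; have h1 := h 1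
  simp only [l1dist, ctr_apply, abs_eq_max_neg]
  omega

/-- Inner boxes of other tiles avoid the arena. [cite: DuminilCopinKozmaYadin2014, §3] -/
theorem disjoint_innerBox_arena {τ τ₀ : Site 2} (h : τ ≠ τ₀) :
    Disjoint (innerBox m r τ) (arena m r τ₀) := by
  have hL := side_eq (m := m) (r := r); have hh := hw_eq (m := m) (r := r)
  rw [Finset.disjoint_left]
  intro w hw hw'
  rw [mem_innerBox_iff, Fin.forall_fin_two] at hw
  rw [mem_arena_iff, Fin.forall_fin_two] at hw'
  rw [Ne, site_eq_iff, not_and_or] at h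
  rcases h with hi | hi <;> rcases lt_or_gt_of_ne hi with hi | hi <;>
    have := side_mul_le (m := m) (r := r) hi <;> omega

/-- Connectors towards the east between two tiles other than `τ₀` avoid the arena of `τ₀`.
[cite: DuminilCopinKozmaYadin2014, §3] -/
theorem disjoint_connCells_arena_E {τ τ₀ : Site 2} (h : τ ≠ τ₀) (h' : τ + Dir.E.vec ≠ τ₀) :
    Disjoint (connCells m r τ .E) (arena m r τ₀) := by
  have hL := side_eq (m := m) (r := r); have hh := hw_eq (m := m) (r := r)
  rw [Finset.disjoint_left]
  intro w hw hw'
  rw [mem_connCells_iff, mem_connInnerA_iff, mem_connInnerB_iff] at hw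
  simp only at hw
  rw [mem_arena_iff, Fin.forall_fin_two] at hw'
  have hw0 : ∃ k : ℕ, k ≤ 2 * r ∧ w 0 = (side m r : ℤ) * τ 0 + m + 1 + k := by
    rcases hw with ⟨k, hk, h0, -⟩ | ⟨k, hk, h0, -⟩ <;> exact ⟨k, hk, h0⟩
  have hw1 : (side m r : ℤ) * τ 1 - 1 ≤ w 1 ∧ w 1 ≤ (side m r : ℤ) * τ 1 := by
    rcases hw with ⟨k, hk, -, h1⟩ | ⟨k, hk, -, h1⟩ <;> omega
  obtain ⟨k, hk, h0⟩ := hw0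
  by_cases h1 : τ 1 = τ₀ 1
  · rw [h1] at hw1
    have h0ne : τ 0 ≠ τ₀ 0 := fun h0' => h ((site_eq_iff _ _).2 ⟨h0', h1⟩)
    have h0ne' : τ 0 + 1 ≠ τ₀ 0 := fun h0' =>
      h' ((site_eq_iff _ _).2 ⟨by simpa [Dir.vec] using h0', by simpa [Dir.vec] using h1⟩)
    rcases lt_trichotomy (τ 0 + 1) (τ₀ 0) with ht | ht | ht
    · have := side_mul_le (m := m) (r := r) ht
      rw [mul_add, mul_one] at this
      omega
    · exact h0ne' ht
    · have ht' : τ₀ 0 < τ 0 := by omega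
      have := side_mul_le (m := m) (r := r) ht'
      omega
  · rcases lt_or_gt_of_ne h1 with ht | ht <;> have := side_mul_le (m := m) (r := r) ht <;> omega

/-- Connectors towards the north between two tiles other than `τ₀` avoid the arena of `τ₀`.
[cite: DuminilCopinKozmaYadin2014, §3] -/
theorem disjoint_connCells_arena_N {τ τ₀ : Site 2} (h : τ ≠ τ₀) (h' : τ + Dir.N.vec ≠ τ₀) :
    Disjoint (connCells m r τ .N) (arena m r τ₀) := by
  have hL := side_eq (m := m) (r := r); have hh := hw_eq (m := m) (r := r)
  rw [Finset.disjoint_left]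
  intro w hw hw'
  rw [mem_connCells_iff, mem_connInnerA_iff, mem_connInnerB_iff] at hw
  simp only at hw
  rw [mem_arena_iff, Fin.forall_fin_two] at hw'
  have hw1 : ∃ k : ℕ, k ≤ 2 * r ∧ w 1 = (side m r : ℤ) * τ 1 + m + 1 + k := by
    rcases hw with ⟨k, hk, -, h1⟩ | ⟨k, hk, -, h1⟩ <;> exact ⟨k, hk, h1⟩
  have hw0 : (side m r : ℤ) * τ 0 - 1 ≤ w 0 ∧ w 0 ≤ (side m r : ℤ) * τ 0 := by
    rcases hw with ⟨k, hk, h0, -⟩ | ⟨k, hk, h0, -⟩ <;> omega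
  obtain ⟨k, hk, h1⟩ := hw1
  by_cases h0 : τ 0 = τ₀ 0
  · rw [h0] at hw0
    have h1ne : τ 1 ≠ τ₀ 1 := fun h1' => h ((site_eq_iff _ _).2 ⟨h0, h1'⟩)
    have h1ne' : τ 1 + 1 ≠ τ₀ 1 := fun h1' =>
      h' ((site_eq_iff _ _).2 ⟨by simpa [Dir.vec] using h0, by simpa [Dir.vec] using h1'⟩)
    rcases lt_trichotomy (τ 1 + 1) (τ₀ 1) with ht | ht | ht
    · have := side_mul_le (m := m) (r := r) ht
      rw [mul_add, mul_one] at this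
      omega
    · exact h1ne' ht
    · have ht' : τ₀ 1 < τ 1 := by omega
      have := side_mul_le (m := m) (r := r) ht'
      omega
  · rcases lt_or_gt_of_ne h0 with ht | ht <;> have := side_mul_le (m := m) (r := r) ht <;> omega

/-- Connectors between two tiles other than `τ₀` avoid the arena of `τ₀`. [cite: DuminilCopinKozmaYadin2014, §3] -/
theorem disjoint_connCells_arena {τ τ₀ : Site 2} {d : Dir} (h : τ ≠ τ₀) (h' : τ + d.vec ≠ τ₀) :
    Disjoint (connCells m r τ d) (arena m r τ₀) := by
  cases d with
  | E => exact disjoint_connCells_arena_E h h'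
  | N => exact disjoint_connCells_arena_N h h'
  | W =>
    rw [connCells_eq_neg]
    refine disjoint_connCells_arena_E h' ?_
    simpa [Dir.vec, add_assoc] using h
  | S =>
    rw [connCells_eq_neg]
    refine disjoint_connCells_arena_N h' ?_
    simpa [Dir.vec, add_assoc] using h

/-- The site one step from the port of `τ₀ + d` (facing `τ₀`) towards `τ₀` lies on the boundary
of the arena of `τ₀`, on the side facing `d`, at offset `-1` (for `portA`) along that side.
[cite: DuminilCopinKozmaYadin2014, §3] -/
theorem portA_step_coords (τ₀ : Site 2) (d : Dir) :
    let a' := portA m r (τ₀ + d.vec) d.neg + d.neg.vec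
    match d with
    | .E => a' 0 = (side m r : ℤ) * τ₀ 0 + (hw m r + r) ∧ a' 1 = (side m r : ℤ) * τ₀ 1 - 1
    | .N => a' 1 = (side m r : ℤ) * τ₀ 1 + (hw m r + r) ∧ a' 0 = (side m r : ℤ) * τ₀ 0 - 1
    | .W => a' 0 = (side m r : ℤ) * τ₀ 0 - (hw m r + r + 1) ∧ a' 1 = (side m r : ℤ) * τ₀ 1 - 1
    | .S => a' 1 = (side m r : ℤ) * τ₀ 1 - (hw m r + r + 1) ∧ a' 0 = (side m r : ℤ) * τ₀ 0 - 1 := by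
  cases d <;> simp only [portA, Dir.neg, Dir.vec, pt_apply_zero, pt_apply_one,
    Pi.add_apply, side_eq, hw_eq] <;> constructor <;> ring

/-- Same for `portB` (offset `0` along the side). [cite: DuminilCopinKozmaYadin2014, §3] -/
theorem portB_step_coords (τ₀ : Site 2) (d : Dir) :
    let b' := portB m r (τ₀ + d.vec) d.neg + d.neg.vec
    match d with
    | .E => b' 0 = (side m r : ℤ) * τ₀ 0 + (hw m r + r) ∧ b' 1 = (side m r : ℤ) * τ₀ 1
    | .N => b' 1 = (side m r : ℤ) * τ₀ 1 + (hw m r + r) ∧ b' 0 = (side m r : ℤ) * τ₀ 0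
    | .W => b' 0 = (side m r : ℤ) * τ₀ 0 - (hw m r + r + 1) ∧ b' 1 = (side m r : ℤ) * τ₀ 1
    | .S => b' 1 = (side m r : ℤ) * τ₀ 1 - (hw m r + r + 1) ∧ b' 0 = (side m r : ℤ) * τ₀ 0 := by
  cases d <;> simp only [portB, Dir.neg, Dir.vec, pt_apply_zero, pt_apply_one,
    Pi.add_apply, side_eq, hw_eq] <;> constructor <;> ring

/-- These two sites belong to the arena. [cite: DuminilCopinKozmaYadin2014, §3] -/
theorem port_steps_mem_arena (τ₀ : Site 2) (d : Dir) :
    portA m r (τ₀ + d.vec) d.neg + d.neg.vec ∈ arena m r τ₀ ∧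
      portB m r (τ₀ + d.vec) d.neg + d.neg.vec ∈ arena m r τ₀ := by
  have hL := side_eq (m := m) (r := r); have hh := hw_eq (m := m) (r := r)
  rw [mem_arena_iff, mem_arena_iff, Fin.forall_fin_two, Fin.forall_fin_two]
  cases d <;> simp only [portA, portB, Dir.neg, Dir.vec, pt_apply_zero, pt_apply_one,
    Pi.add_apply, mul_add, mul_one, mul_neg, add_zero] <;> omega

/-- The ports themselves are just outside the arena (in the inner box of the neighbour). [folklore] -/
theorem ports_not_mem_arena (τ₀ : Site 2) (d : Dir) :
    portA m r (τ₀ + d.vec) d.neg ∉ arena m r τ₀ ∧ portB m r (τ₀ + d.vec) d.neg ∉ arena m r τ₀ := by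
  have hne : τ₀ + d.vec ≠ τ₀ := by
    intro h
    have := Dir.vec_ne_zero d
    exact this (by simpa using h)
  exact ⟨fun h => Finset.disjoint_left.1 (disjoint_innerBox_arena hne) (portA_mem_innerBox _ _) h,
    fun h => Finset.disjoint_left.1 (disjoint_innerBox_arena hne) (portB_mem_innerBox _ _) h⟩

end OddTile

end Literature.Probability.RandomPlanarGeometry.SAW
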